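import Summits.QuantumFields.YangMills.Theorems.QuantileBitPurityEquatorBandVanishing
import Summits.QuantumFields.YangMills.Theorems.QuantileBitPurityHolonomyQuantileSubQuartic
import Summits.QuantumFields.YangMills.Theorems.QuantileBitPurityHolonomyLevyWindowDeepR
import Summits.QuantumFields.YangMills.Theorems.QuantileBitPurityQuantileBitDoorDeepR
import HarnessLib

/-!
# The femto-window PURITY DEFICIT of the zero-flux thermal state is unconditional

Support module of route `QuantileBitPurity` (toward its target leaf `ThermalTraceWindow.SubFemtoTraceRatio`, item stmt-QuantumFields-28257).
With the three cruxes h₁ `HolonomyQuantileSubQuartic` (✓ `holonomyQuantileSubQuartic_proof`), h₂ `EquatorBandVanishing`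
(✓ `equatorBandVanishing_proof`, this seat) and h₃ `HolonomyLevyWindowDeepR` (✓ `holonomyLevyWindowDeepR_proof`) all kernel-checked, the restricted
door `quantileBitDoorDeepR_proof` yields, WITHOUT any hypothesis:

★ `purityDeficit_femtoWindow`: there are `a > 0`, `k`, `β₀`, `L₀` such that for `β ≥ β₀` and every `L₀ ≤ L ≤ β^a`
`Z_phys(L³ × 2L) ≤ (1 − β^(−k)) · Z_phys(L³ × L)²`,
i.e. the zero-flux Gibbs state `ρ_L = T^L / Z_phys(L)` at temperature `1/L` has purity `Tr ρ_L² ≤ 1 − β^(−k)` on the femto window — its top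
transfer-matrix level does not carry all the weight there.

HONEST FRAMING: this is `SubFemtoTraceRatio` ⟨28257⟩ RESTRICTED to the femto window `L ≤ β^a`; the polynomial tail `β^a ≤ L ≤ β^A`
(`QuantileBitPurity.PurityDeficitPolyTail` ⟨23924⟩, declared residual) is NOT touched, so neither ⟨28257⟩ nor any summit conjunct is proved; fixed-lattice
statement, nothing about infinite volume or the continuum; the Yang–Mills mass gap is NOT proved.  No `sorry`, no new axiom, no new definition.
References: [cite: MadrasSokal1988, §2]; [cite: ReedSimonIV1978, Thm. XIII.1]; [cite: MontvayMunster1994, (3.145)]; [cite: Luscher1983, §2].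
-/

set_option autoImplicit false

noncomputable section

namespace Summit.QuantumFields.YangMills.Theorems.QuantileBitPurity

/-- ★ **Femto-window purity deficit, unconditional**: `∃ a > 0, ∃ k β₀ L₀, ∀ β ≥ β₀, ∀ L₀ ≤ L ≤ β^a, Z_phys(2L) ≤ (1 − β^(−k)) · Z_phys(L)²` for the
zero-flux `SU(2)` transfer matrix on `L³` — the restricted quantile-bit door fed with the three proved cruxes of route `QuantileBitPurity`.  The polynomial
tail and the YM mass gap are NOT proved. [cite: MadrasSokal1988, §2] [cite: MontvayMunster1994, (3.145)] -/
theorem purityDeficit_femtoWindow :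
    ∃ a : ℝ, 0 < a ∧ ∃ k β₀ : ℝ, ∃ L₀ : ℕ, ∀ β : ℝ, β₀ ≤ β → ∀ (L : ℕ) [NeZero L], L₀ ≤ L → (L : ℝ) ≤ β ^ a →
      FemtoTransferGap.TT.physTrace L β (2 * L) ≤ (1 - β ^ (-k)) * FemtoTransferGap.TT.physTrace L β L ^ 2 :=
  quantileBitDoorDeepR_proof holonomyQuantileSubQuartic_proof equatorBandVanishing_proof holonomyLevyWindowDeepR_proof

end Summit.QuantumFields.YangMills.Theorems.QuantileBitPurity

end
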